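import Literature.Computability.QuantumComplexity.ForrelationDerivativeTables
import Literature.Computability.QuantumComplexity.ForrelationSignTransport
import Summits.QuantumAdvantage.QuantumAdvantage.Theorems.CubicForrelationNearExactIsExactInvariantWeight

/-!
# Crux `CubicForrelation.NearExactIsExact` (stmt-QuantumAdvantage-14043), line `direct-sum-amplification` —
stub UR: the uniform row defect of the derivative Walsh tables

UNIFORM ROW DEFECT. For Boolean `f g : {0,1}ⁿ → {0,1}` read through `signOf` (`F = (−1)^f`, `G = (−1)^g`) the
derivative Walsh tables `T_F(h,u) = Σ_x F(x) F(x ⊕ h) (−1)^{u·x}` (`DerivativeWalsh.dwt`) satisfy the AVERAGE identity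
`Σ_{h,u} T_F(h,u) T_G(u,h) = 8ⁿ Φ(f,g)²` (tree, `two_pow_mul_forrelation_sq`). This file upgrades it to an
EVERY-DIRECTION lower bound: for every shift `h`,

  `Σ_u T_F(h,u) · T_G(u,h) ≥ 4ⁿ · (1 − 8 (1 − Φ(f,g)²))`            (`stub_uniformRowDefect`),

valid for ALL Boolean `f, g` (no degree hypothesis).

Proof. Put `P(x) = F(x) W_G(x)` with the unnormalised Walsh transform `W_G` of the tree. ROW IDENTITY
(`ur_row_identity`): `Σ_u T_F(h,u) T_G(u,h) = Σ_x P(x) P(x ⊕ h)` (from `sum_dwt_mul_dwt_row` and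
`(−1)^{y·x} (−1)^{h·y} = (−1)^{y·(x ⊕ h)}`). MASS (`ur_mass`): `Σ P² = 4ⁿ` (Parseval `sum_W_sq`). MEAN: `Σ P = S(F,G) =
√(2^{3n}) Φ`, so `(Σ P)² = 2ⁿ · 4ⁿ · Φ²`. SHIFT ENERGY `L(h) = Σ_x (P(x) − P(x ⊕ h))² = 2·4ⁿ − 2 Σ_x P(x)P(x ⊕ h)`
(`ur_energy_expand`) with `Σ_h L(h) = 2ⁿ · M`, `M = 2·4ⁿ(1 − Φ²)` (`ur_energy_total`, `ur_corr_sum`). SUBADDITIVITY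
(`ur_subadd`): `L(s₁ ⊕ s₂) ≤ 2 L(s₁) + 2 L(s₂)`. MARKOV + PIGEONHOLE (`ur_markov`, `ur_translate_meet`, `ur_pigeonhole`):
the good set `S = {s : L(s) ≤ 2M}` has `2|S| > 2ⁿ`, so `S` meets its translate `h ⊕ S`, i.e. `h = s₁ ⊕ s₂` with
`s₁, s₂ ∈ S`, whence `L(h) ≤ 8M = 16·4ⁿ(1 − Φ²)` and `Σ_x P(x)P(x ⊕ h) = 4ⁿ − L(h)/2 ≥ 4ⁿ(1 − 8(1 − Φ²))`
(`ur_corr_lower`).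

Sources: S. Aaronson, A. Ambainis, *Forrelation*, SIAM J. Comput. 47 (2018), §1.1.1 (`Φ`); R. O'Donnell, *Analysis of
Boolean Functions* (2014), §1.4 (characters, Parseval). Everything below is proved from Mathlib and the tree (`dwt`, `W`,
`fsum`, `sum_dwt_mul_dwt_row`, `sum_W_sq`, `fsum_eq_sum_mul_W`, `fsum_signOf_eq`, `twist_bxor_right`, `bxorPerm`,
`signOf_sq`, and `iw_bxor_assoc` of the landed `…InvariantWeight` file); axioms are the standard three.
-/

set_option linter.dupNamespace false -- D-0017: single-problem summit ⇒ `QuantumAdvantage.QuantumAdvantage` by design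

noncomputable section

namespace Summit.QuantumAdvantage.QuantumAdvantage.Theorems.CubicForrelation.NearExactIsExact

open Finset
open Literature.Computability.QuantumComplexity
open Literature.Computability.QuantumComplexity.BuzetChailloux (bxor zeroVec bxor_comm bxorPerm bxorPerm_apply
  twist_bxor_right signOf_sq)
open Literature.Computability.QuantumComplexity.DerivativeWalsh (dwt W fsum fsum_eq_sum_mul_W sum_dwt_mul_dwt_row
  sum_W_sq fsum_signOf_eq)

variable {n : ℕ}

/-! ### Bit-vector bookkeeping -/

/-- Right cancellation: `(h ⊕ s) ⊕ s = h` (associativity is the landed `iw_bxor_assoc`). -/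
theorem ur_bxor_cancel_right (h s : Fin n → Bool) : bxor (bxor h s) s = h := by
  rw [iw_bxor_assoc, BuzetChailloux.bxor_self, BuzetChailloux.bxor_zeroVec]

/-- Translation invariance of a full sum: `Σ_x Q(x ⊕ h) = Σ_x Q(x)` (reindex by the involution `x ↦ h ⊕ x`). -/
theorem ur_sum_shift (Q : (Fin n → Bool) → ℝ) (h : Fin n → Bool) :
    ∑ x, Q (bxor x h) = ∑ x, Q x := by
  calc ∑ x, Q (bxor x h) = ∑ x, Q (bxorPerm h x) :=
        sum_congr rfl fun x _ => by rw [bxorPerm_apply, bxor_comm]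
    _ = ∑ x, Q x := Equiv.sum_comp (bxorPerm h) Q

/-! ### The row identity, mass and mean of `P = F · W_G` -/

/-- **Row identity**: for all real `F, G` and every shift `h`,
`Σ_u T_F(h,u) T_G(u,h) = Σ_x (F(x) W_G(x)) · (F(x ⊕ h) W_G(x ⊕ h))` — the transposed-row inner product of the
two derivative Walsh tables is the autocorrelation at `h` of `P = F · W_G` (from `sum_dwt_mul_dwt_row` and
`(−1)^{y·x} (−1)^{h·y} = (−1)^{y·(x ⊕ h)}`). -/
theorem ur_row_identity (F G : (Fin n → Bool) → ℝ) (h : Fin n → Bool) :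
    ∑ u, dwt F h u * dwt G u h = ∑ x, (F x * W G x) * (F (bxor x h) * W G (bxor x h)) := by
  rw [sum_dwt_mul_dwt_row]
  refine sum_congr rfl fun x _ => ?_
  have hW : ∑ y, G y * twist y x * twist h y = W G (bxor x h) := by
    unfold W
    refine sum_congr rfl fun y _ => ?_
    rw [twist_bxor_right, twist_comm h y]
    ring
  rw [hW]
  ring

/-- **Mass**: for `±1`-valued `F, G`, `Σ_x (F(x) W_G(x))² = 4ⁿ` (Parseval `Σ W_G² = 2ⁿ Σ G² = 4ⁿ`). -/
theorem ur_mass (F G : (Fin n → Bool) → ℝ) (hF : ∀ x, F x ^ 2 = 1) (hG : ∀ y, G y ^ 2 = 1) :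
    ∑ x, (F x * W G x) ^ 2 = (4 : ℝ) ^ n := by
  simp_rw [mul_pow, hF, one_mul]
  rw [sum_W_sq]
  simp_rw [hG, sum_const, card_univ, Fintype.card_fun, Fintype.card_bool, Fintype.card_fin,
    nsmul_eq_mul, mul_one]
  push_cast
  rw [← mul_pow]
  norm_num

/-! ### Shift energy of a real function on the cube -/

/-- **Correlation sum**: `Σ_h Σ_x P(x) P(x ⊕ h) = (Σ_x P(x))²` (for fixed `x`, `h ↦ x ⊕ h` is a bijection). -/
theorem ur_corr_sum (P : (Fin n → Bool) → ℝ) :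
    ∑ h, ∑ x, P x * P (bxor x h) = (∑ x, P x) ^ 2 := by
  rw [sum_comm]
  have e : ∀ x : Fin n → Bool, ∑ h, P x * P (bxor x h) = P x * ∑ y, P y := by
    intro x
    rw [← mul_sum]
    congr 1
    exact Equiv.sum_comp (bxorPerm x) P
  rw [sum_congr rfl fun x _ => e x, ← sum_mul, sq]

/-- **Shift energy, expanded**: `Σ_x (P(x) − P(x ⊕ h))² = 2 Σ_x P(x)² − 2 Σ_x P(x) P(x ⊕ h)` (the shifted
square-sum equals `Σ P²` by translation invariance). -/
theorem ur_energy_expand (P : (Fin n → Bool) → ℝ) (h : Fin n → Bool) :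
    ∑ x, (P x - P (bxor x h)) ^ 2 = 2 * ∑ x, P x ^ 2 - 2 * ∑ x, P x * P (bxor x h) := by
  have e : ∀ x : Fin n → Bool,
      (P x - P (bxor x h)) ^ 2 = P x ^ 2 + P (bxor x h) ^ 2 - 2 * (P x * P (bxor x h)) :=
    fun x => by ring
  rw [sum_congr rfl fun x _ => e x, sum_sub_distrib, sum_add_distrib, ← mul_sum,
    ur_sum_shift (fun x => P x ^ 2) h]
  ring

/-- **Total shift energy**: `Σ_h Σ_x (P(x) − P(x ⊕ h))² = 2·2ⁿ Σ_x P(x)² − 2 (Σ_x P(x))²`. -/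
theorem ur_energy_total (P : (Fin n → Bool) → ℝ) :
    ∑ h, ∑ x, (P x - P (bxor x h)) ^ 2 = 2 * (2 : ℝ) ^ n * ∑ x, P x ^ 2 - 2 * (∑ x, P x) ^ 2 := by
  rw [sum_congr rfl fun h _ => ur_energy_expand P h, sum_sub_distrib, sum_const, card_univ, ← mul_sum,
    ur_corr_sum, Fintype.card_fun, Fintype.card_bool, Fintype.card_fin, nsmul_eq_mul]
  push_cast
  ring

/-- **Subadditivity of the shift energy** `L(s) = Σ_x (P(x) − P(x ⊕ s))²`: `L(s₁ ⊕ s₂) ≤ 2 L(s₁) + 2 L(s₂)`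
(write `P(x) − P(x ⊕ s₁ ⊕ s₂) = (P(x) − P(x ⊕ s₁)) + (P(x ⊕ s₁) − P(x ⊕ s₁ ⊕ s₂))`, use `(a + b)² ≤ 2a² + 2b²`, and
reindex the second square-sum by `x ↦ x ⊕ s₁`). -/
theorem ur_subadd (P : (Fin n → Bool) → ℝ) (s₁ s₂ : Fin n → Bool) :
    ∑ x, (P x - P (bxor x (bxor s₁ s₂))) ^ 2 ≤
      2 * ∑ x, (P x - P (bxor x s₁)) ^ 2 + 2 * ∑ x, (P x - P (bxor x s₂)) ^ 2 := by
  have hshift : ∑ x, (P (bxor x s₁) - P (bxor (bxor x s₁) s₂)) ^ 2 = ∑ x, (P x - P (bxor x s₂)) ^ 2 :=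
    ur_sum_shift (fun z => (P z - P (bxor z s₂)) ^ 2) s₁
  rw [← hshift, mul_sum, mul_sum, ← sum_add_distrib]
  refine sum_le_sum fun x _ => ?_
  rw [← iw_bxor_assoc]
  nlinarith [sq_nonneg (P x - P (bxor x s₁) - (P (bxor x s₁) - P (bxor (bxor x s₁) s₂)))]

/-! ### Markov and pigeonhole on the cube -/

/-- **Markov step**: if `L ≥ 0` on the cube has total `Σ_s L(s) = 2ⁿ M`, then the good set `{s : L(s) ≤ 2M}` has
more than `2ⁿ/2` elements (outside it `L > 2M`, so its complement has fewer than `2ⁿ/2` elements; if the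
complement is empty the good set is everything). -/
theorem ur_markov (L : (Fin n → Bool) → ℝ) (M : ℝ) (hL0 : ∀ s, 0 ≤ L s)
    (hsum : ∑ s, L s = (2 : ℝ) ^ n * M) :
    2 ^ n < 2 * (univ.filter (fun s => L s ≤ 2 * M)).card := by
  have hsplit : (univ.filter (fun s => L s ≤ 2 * M)).card +
      (univ.filter (fun s => ¬ (L s ≤ 2 * M))).card = 2 ^ n := by
    rw [card_filter_add_card_filter_not, card_univ, Fintype.card_fun, Fintype.card_bool,
      Fintype.card_fin]
  rcases (univ.filter (fun s => ¬ (L s ≤ 2 * M))).eq_empty_or_nonempty with hemp | hne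
  · rw [hemp, card_empty, add_zero] at hsplit
    have hpos : 0 < 2 ^ n := Nat.pos_of_ne_zero (pow_ne_zero n two_ne_zero)
    omega
  · have hlt : ∑ s ∈ univ.filter (fun s => ¬ (L s ≤ 2 * M)), 2 * M <
        ∑ s ∈ univ.filter (fun s => ¬ (L s ≤ 2 * M)), L s :=
      sum_lt_sum_of_nonempty hne fun s hs => not_le.1 (mem_filter.1 hs).2
    rw [sum_const, nsmul_eq_mul] at hlt
    have hle : ∑ s ∈ univ.filter (fun s => ¬ (L s ≤ 2 * M)), L s ≤ ∑ s, L s :=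
      sum_le_sum_of_subset_of_nonneg (filter_subset _ _) fun s _ _ => hL0 s
    rw [hsum] at hle
    have hM0 : 0 ≤ M := by
      have h0 : 0 ≤ ∑ s, L s := sum_nonneg fun s _ => hL0 s
      rw [hsum] at h0
      exact nonneg_of_mul_nonneg_right h0 (by positivity)
    have h1 : 2 * ((univ.filter (fun s => ¬ (L s ≤ 2 * M))).card : ℝ) * M < 2 ^ n * M := by
      linarith
    have h2 : 2 * ((univ.filter (fun s => ¬ (L s ≤ 2 * M))).card : ℝ) < 2 ^ n :=
      lt_of_mul_lt_mul_right h1 hM0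
    have h3 : 2 * (univ.filter (fun s => ¬ (L s ≤ 2 * M))).card < 2 ^ n := by
      exact_mod_cast h2
    omega

/-- **Pigeonhole step**: a subset `S` of the cube with `2|S| > 2ⁿ` meets each of its translates, so every `h`
is a difference `h = s₁ ⊕ s₂` of two elements of `S`. -/
theorem ur_translate_meet (S : Finset (Fin n → Bool)) (hbig : 2 ^ n < 2 * S.card) (h : Fin n → Bool) :
    ∃ s₁ ∈ S, ∃ s₂ ∈ S, bxor s₁ s₂ = h := by
  have hU : Fintype.card (Fin n → Bool) = 2 ^ n := by
    rw [Fintype.card_fun, Fintype.card_bool, Fintype.card_fin]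
  have hTcard : (S.image (bxorPerm h)).card = S.card :=
    card_image_of_injective S (bxorPerm h).injective
  have h1 := card_union_add_card_inter S (S.image (bxorPerm h))
  have h2 : (S ∪ S.image (bxorPerm h)).card ≤ 2 ^ n := hU ▸ card_le_univ _
  have hpos : 0 < (S ∩ S.image (bxorPerm h)).card := by omega
  obtain ⟨s₁, hs₁⟩ := card_pos.1 hpos
  rw [mem_inter, mem_image] at hs₁
  obtain ⟨hs₁S, s₂, hs₂S, hs₂eq⟩ := hs₁
  refine ⟨s₁, hs₁S, s₂, hs₂S, ?_⟩
  rw [← hs₂eq, bxorPerm_apply]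
  exact ur_bxor_cancel_right h s₂

/-- **Markov + pigeonhole**: if `L ≥ 0` on the cube has total `2ⁿ M` and is subadditive in the sense
`L(s₁ ⊕ s₂) ≤ 2 L(s₁) + 2 L(s₂)`, then `L(h) ≤ 8M` for EVERY `h` (write `h = s₁ ⊕ s₂` with both `L(sᵢ) ≤ 2M`). -/
theorem ur_pigeonhole (L : (Fin n → Bool) → ℝ) (M : ℝ) (hL0 : ∀ s, 0 ≤ L s)
    (hsum : ∑ s, L s = (2 : ℝ) ^ n * M) (hsub : ∀ s₁ s₂, L (bxor s₁ s₂) ≤ 2 * L s₁ + 2 * L s₂)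
    (h : Fin n → Bool) : L h ≤ 8 * M := by
  obtain ⟨s₁, hs₁, s₂, hs₂, hh⟩ :=
    ur_translate_meet (univ.filter (fun s => L s ≤ 2 * M)) (ur_markov L M hL0 hsum) h
  have hL1 : L s₁ ≤ 2 * M := (mem_filter.1 hs₁).2
  have hL2 : L s₂ ≤ 2 * M := (mem_filter.1 hs₂).2
  have key := hsub s₁ s₂
  rw [hh] at key
  linarith

/-! ### The uniform autocorrelation lower bound and the row defect -/

/-- **Uniform autocorrelation lower bound**: if `P` on the cube has `Σ P² = m` and `(Σ P)² = 2ⁿ · m · Φ²`, then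
for EVERY shift `h`, `Σ_x P(x) P(x ⊕ h) ≥ m (1 − 8 (1 − Φ²))` (the shift energy `L(h) = 2m − 2 Σ_x P(x)P(x ⊕ h)` has
total `2ⁿ · 2m(1 − Φ²)`, hence `L(h) ≤ 16 m (1 − Φ²)` by `ur_pigeonhole`). -/
theorem ur_corr_lower (P : (Fin n → Bool) → ℝ) (m Φ : ℝ) (hm : ∑ x, P x ^ 2 = m)
    (hΦ : (∑ x, P x) ^ 2 = (2 : ℝ) ^ n * m * Φ ^ 2) (h : Fin n → Bool) :
    m * (1 - 8 * (1 - Φ ^ 2)) ≤ ∑ x, P x * P (bxor x h) := by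
  have hL : ∑ x, (P x - P (bxor x h)) ^ 2 ≤ 8 * (2 * m * (1 - Φ ^ 2)) :=
    ur_pigeonhole (fun s => ∑ x, (P x - P (bxor x s)) ^ 2) (2 * m * (1 - Φ ^ 2))
      (fun s => sum_nonneg fun x _ => sq_nonneg _)
      (by
        show ∑ s, ∑ x, (P x - P (bxor x s)) ^ 2 = _
        rw [ur_energy_total, hm, hΦ]
        ring)
      (fun s₁ s₂ => ur_subadd P s₁ s₂) h
  rw [ur_energy_expand, hm] at hL
  linarith

/-- **stub stub_uniformRowDefect** (UNIFORM ROW DEFECT): for Boolean `f g : {0,1}ⁿ → {0,1}` and EVERY shift `h`,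
the transposed-row inner product of the derivative Walsh tables of `(−1)^f` and `(−1)^g` satisfies
`Σ_u T_f(h,u) T_g(u,h) ≥ 4ⁿ (1 − 8 (1 − Φ(f,g)²))` — the average statement `Σ_{h,u} T_f T_gᵀ = 8ⁿ Φ²` upgraded to
every direction (`ur_row_identity` + `ur_corr_lower` with `P = (−1)^f · W_{(−1)^g}`, `m = 4ⁿ`, `Σ P = √(2^{3n}) Φ`). -/
theorem stub_uniformRowDefect :
    ∀ (n : ℕ) (f g : (Fin n → Bool) → Bool) (h : Fin n → Bool),
      (4 : ℝ) ^ n * (1 - 8 * (1 - forrelation f g ^ 2)) ≤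
        ∑ u, dwt (fun x => signOf (f x)) h u * dwt (fun y => signOf (g y)) u h := by
  intro n f g h
  rw [ur_row_identity]
  refine ur_corr_lower (fun x => signOf (f x) * W (fun y => signOf (g y)) x) ((4 : ℝ) ^ n)
    (forrelation f g) (ur_mass _ _ (fun x => signOf_sq (f x)) (fun y => signOf_sq (g y))) ?_ h
  show (∑ x, signOf (f x) * W (fun y => signOf (g y)) x) ^ 2 = _
  rw [← fsum_eq_sum_mul_W, fsum_signOf_eq, mul_pow, Real.sq_sqrt (by positivity), pow_mul, ← mul_pow]
  norm_num

end Summit.QuantumAdvantage.QuantumAdvantage.Theorems.CubicForrelation.NearExactIsExact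

end
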